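import Summits.QuantumFields.YangMills.Theorems.BalabanUVNodesK0VariationalThm1C1Floor
import Literature.MathematicalPhysics.QuantumFieldTheory.Balaban1983to89.B14SeparationOfRecord

/-!
# K0⁶ ROW P11 — TORUS GEOMETRY OF THE TOP INDEX (`Ω_j = T_η`), THE WRAPPING [I]-CUBE, AND AN `SU(N)` ROOT OF `−1` — the geometric half of the WRAP WITNESS for the ∃-gauge
# edition of the [15]-fact (companions: FILE 24A `…K0ConstantDirectionTower`, 24C `…K0VariationalThm1GaugeWrap`, 24D `…K0VariationalThm1GaugeFloors`)

Cell `pub-ymgap`, seat `pub-ymgap-dag-n21-c` g10 (R134 (a) N21 NE7c s1; K0 ROW P11 negative lane of record for the [15]-fact editions; INBOX CENSUS + INTENT-1 l.20027,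
dag-lead DEDUP-294 GO).  Filed `--kind proof --supports stmt-QuantumFields-20506 --as helper` (K0⁶ `Record13SepCoPRInhabited`).
[15] = [Balaban1985Variational], [I] = [Balaban1987RG1], [III] = [Balaban1988Convergent], [6] = [Balaban1985RegularSpaces].

WHAT THIS FILE PROVES (theorems only; no `def`).
§1 `exists_cover_eq_box` (every site of the fine torus is `π(z)` with `z ∈ [0, P−1]ᵈ`, `P = sitesPerDir 0`), `cubeEnl_zero_eq_univ_of_le` (a grid cube of side `≥ P` IS the whole torus —
the wrapping «cube» of dag-n07-e's LOCATED-Δ2, INBOX l.19985), `zero_mem_cubeIndices`, `univ_mem_unionsOfCubes` (`T_η` is the union of ALL grid cubes of any positive side: print's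
admissible domain `Ω_j = T_η`, [6] p. 77 after (1.6); r11's (2.1) class `unionsOfCubes`), ★ `exists_seq_top` (THE TOP INDEX: for every cube letter `M ≥ 1` a (2.18)
index `s : SeqOfRecord F ν M g K k` with `Ω_j = T_η` for `1 ≤ j ≤ k` — the leading «no large field anywhere» term, cf. `chiSeqOfRecord_of_top` — separated in the sense of [6] (1.3)–(1.6)
trivially), `sitesPerDir_le_side` (the [I] (1.12) cube of step `K + m` wraps: `side L M (K + m + 1) = L^{K+m+1}·M ≥ 2L^{m+K}` for every `M ≥ 1`, `L ≥ 12`).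
§2 `exists_su_pow_dist1_eq_two`: for `N ≥ 2` and `0 < P` the diagonal `D = diag(e^{iπ∕P}, e^{−iπ∕P}, 1, …, 1) ∈ SU(N)` has `D^P = diag(−1, −1, 1, …, 1)`, `dist1 (D^P) = 2`
(`Matrix.l2_opNorm_diagonal`, `Complex.exp_pi_mul_I`) — the holonomy the wrap witness plants around a torus cycle.

HONEST FRAMING: [folklore] lattice∕matrix bookkeeping about the tree's own objects; nothing of Bałaban asserted or refuted; K0⁶ neither discharged nor refuted; N21 NOT discharged;
counts unmoved (typed 28∕28 · discharged 5∕28); one finite `𝕋⁴` torus family at fixed `ε = L^{−K}`; not continuum ∕ OS ∕ mass gap ∕ Clay.  THEOREMS ONLY: no `def`, `instance`,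
`notation`, `sorry`; standard axioms.
DEPENDENCES (by name): NODE 00 `SeqOfRecord ∕ DOfRecord ∕ dCubeSide ∕ unionsOfCubes ∕ mem_unionsOfCubes_iff ∕ cubeIndices ∕ cubeEnl ∕ RkOfRecord`, r11 `B14.Eq218Concrete.Seq ∕ Chain21`,
`Sect2.SeqSeparated` (FILE 1 v1.1), `B14SeparationOfRecord.one_le_RkOfRecord`, `B14.Eq213MaximalDomains.side`, `B15Eq112TorusCover.cover`, `T4Family.sitesPerDir_eq ∕ P_L ∕ P_d`, Mathlib `Matrix.l2_opNorm_diagonal ∕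
Matrix.diagonal_pow ∕ Matrix.det_diagonal ∕ Complex.exp_pi_mul_I`.
-/


noncomputable section

open scoped Matrix.Norms.L2Operator

namespace Summit.QuantumFields.YangMills.Theorems.K0TopIndexWrapGeometry

open Literature.MathematicalPhysics.QuantumFieldTheory.Balaban1983to89
open Literature.MathematicalPhysics.QuantumFieldTheory.Balaban1983to89.Node00
open Literature.MathematicalPhysics.QuantumFieldTheory.Balaban1983to89.T4Continuum
open B15Eq112TorusCover B14DomainGeom B15DeterminingSets B15LatticeCubeTorus BlockAveraging B12RegularSpaces111
open Literature.MathematicalPhysics.QuantumFieldTheory.Balaban1983to89.T3DescentFibreTower (avgFun_one expMeanLogSU_E_one)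
open ExpMeanLog (expMeanLogSU)
open Summit.QuantumFields.YangMills.Theorems.K0BgProvisoOverRange (shift_cover)
open Summit.QuantumFields.YangMills.Theorems.K0VariationalThm1ScaledCorner (cover_zero_mem_cubeEnl_zero RkOfRecord_at_one)
open Summit.QuantumFields.YangMills.BalabanUVNodes.N07SmallActionBoundaryAvoidance (wilsonAction4_le_card_mul_sq mixedField_avg_self)
open Summit.QuantumFields.YangMills.Theorems.K0TopClassSmallActionMinimiser (mem_classTop_of_forall_dist1_lt coDivSmallOn_of_forall_dist1_le)
open Summit.QuantumFields.YangMills.Theorems.K0VariationalThm1C1Floor (cover_mem_cubeEnl_zero_of_le_one)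

/-! ## §1  Torus geometry: every site has a box representative; `univ` is a union of grid cubes; a cube of side `≥` the period IS the torus; the TOP index -/
section Geometry

variable {P : Params}

/-- Every site of the fine torus is `π(z)` for a lattice point `z` of the fundamental box `[0, sitesPerDir 0 − 1]ᵈ` (coordinatewise `ZMod.val`).
[cite: Balaban1988Convergent, (2.1) p.254 (bookkeeping: the torus as a quotient box)] -/
theorem exists_cover_eq_box (c : Site P 0) :
    ∃ z : Pt P.d, (∀ i, 0 ≤ z i ∧ z i + 1 ≤ P.sitesPerDir 0) ∧ cover P z = c := by
  refine ⟨fun i => ((c i).val : ℤ), fun i => ⟨by positivity, ?_⟩, ?_⟩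
  · have := ZMod.val_lt (c i)
    show ((c i).val : ℤ) + 1 ≤ _
    omega
  · funext i
    show (((c i).val : ℤ) : ZMod (P.sitesPerDir 0)) = c i
    rw [Int.cast_natCast, ZMod.natCast_zmod_val]

/-- **A GRID CUBE OF SIDE AT LEAST THE PERIOD IS THE WHOLE TORUS**: `cubeEnl P s 0 0 = univ` once `sitesPerDir 0 ≤ s` — the wrapping «cube».
[cite: Balaban1988Convergent, (2.1) p.254 (bookkeeping); Balaban1987RG1, (1.12) p.262 («cubes □ ⊂ X»)] -/
theorem cubeEnl_zero_eq_univ_of_le {s : ℕ} (hs : P.sitesPerDir 0 ≤ s) : cubeEnl P s 0 0 = Set.univ := by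
  refine Set.eq_univ_of_forall fun c => ?_
  obtain ⟨z, hz, rfl⟩ := exists_cover_eq_box c
  refine ⟨z, fun i => ?_, rfl⟩
  have hs' : (P.sitesPerDir 0 : ℤ) ≤ s := by exact_mod_cast hs
  obtain ⟨h0, h1⟩ := hz i
  simp only [Pi.zero_apply, mul_zero, Nat.zero_mul, Nat.cast_zero, sub_zero, add_zero, zero_add]
  exact ⟨h0, by linarith⟩

/-- The index `0` is a cube index for every positive side. [cite: Balaban1988Convergent, (2.17) p.257 (bookkeeping)] -/
theorem zero_mem_cubeIndices {s : ℕ} (hs : 0 < s) : (0 : Pt P.d) ∈ cubeIndices P s := by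
  rw [cubeIndices, Fintype.mem_piFinset]
  intro i
  refine Finset.mem_image.2 ⟨0, Finset.mem_range.2 (Nat.div_pos ?_ hs), by simp⟩
  have := P.sitesPerDir_ne_zero 0
  omega

/-- **THE WHOLE TORUS IS A UNION OF GRID CUBES** of any positive side `s` (all of them): print's `Ω_j = T_η` is an admissible domain ([6] p. 77 after (1.6)).
[cite: Balaban1988Convergent, (2.1) p.254; Balaban1985RegularSpaces, p.77] -/
theorem univ_mem_unionsOfCubes {s : ℕ} (hs : 0 < s) : (Set.univ : Set (Site P 0)) ∈ unionsOfCubes P s := by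
  rw [mem_unionsOfCubes_iff]
  refine ⟨cubeIndices P s, subset_rfl, (Set.eq_univ_of_forall fun c => ?_).symm⟩
  obtain ⟨z, hz, rfl⟩ := exists_cover_eq_box c
  -- natural coordinates and their cube index
  have hzn : ∀ i, ∃ n : ℕ, z i = n ∧ n + 1 ≤ P.sitesPerDir 0 := fun i => by
    obtain ⟨h0, h1⟩ := hz i
    refine ⟨(z i).toNat, (Int.toNat_of_nonneg h0).symm, ?_⟩
    have := Int.toNat_of_nonneg h0
    omega
  choose n hn hnS using hzn
  set a : Pt P.d := fun i => ((n i / s : ℕ) : ℤ) with ha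
  have haI : a ∈ cubeIndices P s := by
    rw [cubeIndices, Fintype.mem_piFinset]
    intro i
    refine Finset.mem_image.2 ⟨n i / s, Finset.mem_range.2 ?_, rfl⟩
    have h1 : n i / s ≤ (P.sitesPerDir 0 - 1) / s := Nat.div_le_div_right (by have := hnS i; omega)
    have h2 : (P.sitesPerDir 0 + s - 1) / s = (P.sitesPerDir 0 - 1) / s + 1 := by
      have hS := P.sitesPerDir_ne_zero 0
      rw [show P.sitesPerDir 0 + s - 1 = (P.sitesPerDir 0 - 1) + s by omega, Nat.add_div_right _ hs]
    omega
  refine Set.mem_iUnion₂.2 ⟨a, haI, z, fun i => ?_, rfl⟩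
  have hlo : s * (n i / s) ≤ n i := Nat.mul_div_le (n i) s
  have hhi : n i < s * (n i / s) + s := by
    have := Nat.lt_div_mul_add (a := n i) hs
    linarith [Nat.mul_comm (n i / s) s]
  have hlo' : ((s : ℕ) : ℤ) * ((n i / s : ℕ) : ℤ) ≤ (n i : ℤ) := by exact_mod_cast hlo
  have hhi' : (n i : ℤ) < ((s : ℕ) : ℤ) * ((n i / s : ℕ) : ℤ) + s := by exact_mod_cast hhi
  simp only [ha, Nat.zero_mul, Nat.cast_zero, sub_zero, add_zero, hn i]
  exact ⟨hlo', by linarith⟩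

variable (F : T4Family)

/-- **THE TOP INDEX** of length `k` for cube letter `M ≥ 1`: the (2.18) index with EVERY small-field region the whole torus, `Ω_j = Λ_j = T_η` for `1 ≤ j ≤ k` (and `∅` off the
window) — admissible along (2.1) because `T_η` is the union of ALL `𝐃_j`-cubes, and SEPARATED in the sense of [6] (1.3)–(1.6) trivially (`… ⊆ T_η`).  It is the index of the
leading «no large field anywhere» term of (2.18) (`chiSeqOfRecord_of_top`), and print's `Ω_j = T_η` case ([6] p. 77).
[cite: Balaban1988Convergent, (2.1) p.254, (2.18) p.257; Balaban1985RegularSpaces, (1.3)–(1.6) p.77] -/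
theorem exists_seq_top (ν : Stage7Numerics) {M : ℕ} (hM : 1 ≤ M) (g : ℕ → ℝ) (K k : ℕ) :
    ∃ s : SeqOfRecord F ν M g K k, (∀ j, 1 ≤ j → j ≤ k → s.Ω j = Set.univ) ∧ Sect2.SeqSeparated ν.M₁ s := by
  have hL : 1 ≤ F.L := F.hL.2.le
  have hD : ∀ j, (Set.univ : Set (Site (F.P K) 0)) ∈ DOfRecord F ν M g K j := fun j => by
    unfold DOfRecord dCubeSide
    refine univ_mem_unionsOfCubes (Nat.mul_pos (Nat.mul_pos (Nat.pow_pos (by rw [T4Family.P_L]; omega)) hM) ?_)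
    exact B14SeparationOfRecord.one_le_RkOfRecord (by rw [T4Family.P_L]; exact hL) _ _
  refine ⟨⟨fun j => if 1 ≤ j ∧ j ≤ k then Set.univ else ∅, fun j => if 1 ≤ j ∧ j ≤ k then Set.univ else ∅, ⟨?_, ?_, ?_, ?_⟩, ?_, ?_⟩, ?_, ?_⟩
  · intro j h1 hj; rw [if_pos ⟨h1, hj⟩]; exact hD j
  · intro j h1 hj; rw [if_pos ⟨h1, hj⟩]; exact hD j
  · intro j _ _; exact subset_rfl
  · intro j h1 hj; rw [if_pos (show 1 ≤ j ∧ j ≤ k from ⟨h1, hj.le⟩)]; exact Set.subset_univ _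
  · intro j hj; rw [if_neg hj]
  · intro j hj; rw [if_neg hj]
  · intro j h1 hj; show (if 1 ≤ j ∧ j ≤ k then Set.univ else ∅) = Set.univ; rw [if_pos ⟨h1, hj⟩]
  · intro n h1 hn
    show _ ⊆ (if 1 ≤ n ∧ n ≤ k then Set.univ else ∅)
    rw [if_pos ⟨h1, hn.le⟩]; exact Set.subset_univ _

/-- At the top index the I-cube of step `n = k = K + m` wraps: `side L M (K + m + 1) ≥ sitesPerDir 0 = 2L^{m+K}` for every `M ≥ 1` (`L ≥ 12 ≥ 2`).
[cite: Balaban1987RG1, (0.1) p.251, (1.12) p.262 (bookkeeping: cube side vs torus period)] -/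
theorem sitesPerDir_le_side (K : ℕ) {M : ℕ} (hM : 1 ≤ M) :
    (F.P K).sitesPerDir 0 ≤ B14.Eq213MaximalDomains.side (F.P K).L M (K + F.m + 1) := by
  rw [T4Family.sitesPerDir_eq, B14.Eq213MaximalDomains.side, T4Family.P_L]
  have hL : 2 ≤ F.L := by have := F.hL11; omega
  have h1 : F.L ^ (K + F.m + 1) * M ≥ F.L ^ (K + F.m + 1) := Nat.le_mul_of_pos_right _ hM
  have h2 : F.L ^ (K + F.m + 1) = F.L ^ (F.m + K) * F.L := by rw [show K + F.m + 1 = F.m + K + 1 by omega, pow_succ]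
  have h3 : F.L ^ (F.m + K) * 2 ≤ F.L ^ (F.m + K) * F.L := Nat.mul_le_mul_left _ hL
  omega

end Geometry

/-! ## §2  An `SU(N)` element whose `P`-th power is at distance `2` from `1` (`N ≥ 2`): `D = diag(e^{iπ∕P}, e^{−iπ∕P}, 1, …, 1)` -/
section Root

variable {N : ℕ} [NeZero N]

/-- For `N ≥ 2` and `0 < P` there is `D ∈ SU(N)` with `dist1 (D ^ P) = ‖D^P − 1‖ = 2`: `D = diag(e^{iπ∕P}, e^{−iπ∕P}, 1, …, 1)`, `D^P = diag(−1, −1, 1, …, 1)`. [folklore] -/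
theorem exists_su_pow_dist1_eq_two (hN : 2 ≤ N) {Per : ℕ} (hPer : 0 < Per) : ∃ D : SU N, dist1 (D ^ Per) = 2 := by
  obtain ⟨n, rfl⟩ : ∃ n, N = n + 2 := ⟨N - 2, by omega⟩
  set θ : ℂ := (Real.pi : ℂ) * Complex.I / (Per : ℂ) with hθ
  set z : ℂ := Complex.exp θ with hz
  have hPer' : (Per : ℂ) ≠ 0 := by exact_mod_cast hPer.ne'
  have hzP : z ^ Per = -1 := by
    rw [hz, ← Complex.exp_nat_mul, hθ, mul_div_cancel₀ _ hPer', Complex.exp_pi_mul_I]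
  have hzz : z * z⁻¹ = 1 := by
    rw [mul_inv_cancel₀]; rw [hz]; exact Complex.exp_ne_zero _
  have hnz : ‖z‖ = 1 := by
    rw [hz, Complex.norm_exp, hθ]
    simp
  have hzconj : (starRingEnd ℂ) z = z⁻¹ := by
    have h := Complex.mul_conj z
    rw [Complex.normSq_eq_norm_sq, hnz] at h
    simp only [one_pow, Complex.ofReal_one] at h
    have hz0 : z ≠ 0 := by rw [hz]; exact Complex.exp_ne_zero _
    field_simp
    rw [mul_comm] at h
    exact h
  set v : Fin (n + 2) → ℂ := fun i => if i = 0 then z else if i = 1 then z⁻¹ else 1 with hv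
  have hv0 : v 0 = z := by simp [hv]
  have hv1 : v 1 = z⁻¹ := by simp [hv]
  have hvss : ∀ i : Fin n, v i.succ.succ = 1 := fun i => by
    have h0 : i.succ.succ ≠ 0 := Fin.succ_ne_zero _
    have h1 : i.succ.succ ≠ 1 := fun h => Fin.succ_ne_zero i (Fin.succ_injective _ (h.trans Fin.succ_zero_eq_one.symm))
    simp [hv, h0, h1]
  set A : Matrix (Fin (n + 2)) (Fin (n + 2)) ℂ := Matrix.diagonal v with hA
  have hstar : ∀ i, v i * star (v i) = 1 := by
    intro i
    refine Fin.cases ?_ (fun i' => Fin.cases ?_ (fun i'' => ?_) i') i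
    · rw [hv0]; show z * (starRingEnd ℂ) z = 1; rw [hzconj, hzz]
    · show v 1 * star (v 1) = 1
      rw [hv1]; show z⁻¹ * (starRingEnd ℂ) z⁻¹ = 1
      rw [map_inv₀, hzconj, inv_inv, mul_comm, hzz]
    · rw [hvss]; simp
  have hunit : A ∈ Matrix.unitaryGroup (Fin (n + 2)) ℂ := by
    rw [Matrix.mem_unitaryGroup_iff, hA, Matrix.star_eq_conjTranspose, Matrix.diagonal_conjTranspose, Matrix.diagonal_mul_diagonal,
      ← Matrix.diagonal_one]
    congr 1
    funext i
    exact hstar i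
  have hdet : A.det = 1 := by
    rw [hA, Matrix.det_diagonal, Fin.prod_univ_succ, Fin.prod_univ_succ, hv0]
    simp only [Fin.succ_zero_eq_one, hv1, hvss, Finset.prod_const_one, mul_one]
    exact hzz
  refine ⟨⟨A, Matrix.mem_specialUnitaryGroup_iff.mpr ⟨hunit, hdet⟩⟩, ?_⟩
  show ‖((⟨A, _⟩ : SU (n + 2)) ^ Per : SU (n + 2)).1 - 1‖ = 2
  rw [SubmonoidClass.coe_pow]
  show ‖A ^ Per - 1‖ = 2
  have hsub : A ^ Per - 1 = Matrix.diagonal (v ^ Per - 1) := by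
    rw [hA, Matrix.diagonal_pow, ← Matrix.diagonal_one, Matrix.diagonal_sub]; rfl
  rw [hsub, Matrix.l2_opNorm_diagonal]
  have hzP' : (z⁻¹) ^ Per = -1 := by rw [inv_pow, hzP]; norm_num
  have hentry : ∀ i, ‖(v ^ Per - 1) i‖ ≤ 2 ∧ ‖(v ^ Per - 1) 0‖ = 2 := by
    intro i
    refine ⟨?_, by simp [hv0, hzP]; norm_num⟩
    refine Fin.cases ?_ (fun i' => Fin.cases ?_ (fun i'' => ?_) i') i
    · simp [hv0, hzP]; norm_num
    · show ‖v 1 ^ Per - 1‖ ≤ 2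
      rw [hv1, hzP']; norm_num
    · show ‖v i''.succ.succ ^ Per - 1‖ ≤ 2
      rw [hvss]; simp
  refine le_antisymm ((pi_norm_le_iff_of_nonneg (by norm_num)).mpr fun i => (hentry i).1) ?_
  calc (2 : ℝ) = ‖(v ^ Per - 1) 0‖ := (hentry 0).2.symm
    _ ≤ ‖v ^ Per - 1‖ := norm_le_pi_norm _ 0

end Root

end Summit.QuantumFields.YangMills.Theorems.K0TopIndexWrapGeometry

end
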